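import Summits.QuantumFields.BalabanUV.Beta.FP.ExpLocalisedBubbleKernel
import Summits.QuantumFields.BalabanUV.Beta.FP.PerfectPolarization
import Summits.QuantumFields.BalabanUV.Beta.FP.PerfectPropagatorLegDataProducts
import Summits.QuantumFields.BalabanUV.Beta.FP.PerfectPropagatorKernelSymm

/-!
# `BalabanUV.Beta.FP.ExpLocalisedBubblePker` — road «FP», N7 H-route, JUNCTION H2-ASM-1 ∘ H2-ASM-2: THE ONE-LOOP BUBBLE OF THE PERFECT GLUON LEG `Pker`
# AGAINST TWO ZERO-MASS BI-LOCALISED VERTICES = Σ_{fibres} Lead + `O((‖z‖∞+1)⁻⁷)` — the leg letters (L0)–(L3) of `FP/PerfectPropagatorLegData{,Products}` DISCHARGE the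
# leg hypotheses of `FP/ExpLocalisedBubbleKernel.abs_bubble_kernel_sub_lead_le` for BOTH orientations ([our object] wiring; nothing of the manuscripts)

HONEST DEPENDENCY (page 1, mandatory): continuum YM on T⁴ ⇐ BetaPertH ∧ nine spine estimates (0/9 proved); BetaPertH ⇐ (D1) ∧ (D4) ∧
CAP+tail; G-an2-4 gates asym, D1 and NE2/3/4.  HONEST FRAMING (cell contract, verbatim): «discharging `BetaPertH` makes Bałaban's UV
stability UNCONDITIONAL — a real constructive-QFT result; it is NOT the continuum limit and NOT the Clay problem.»  THIS MODULE is wiring BY NAME: `Pker` (H2V-0, p240631),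
its translation invariance `Pker_translate`, the all-`z` letters of `legP := Re PinfKer` (H2-ASM-2: `abs_legP_le`, `abs_fwdDiff_legP_le`, `abs_fwdDiff₂_legP_le`, `abs_fwdDiff₃_legP_le`),
the reflection `KB_neg` + `latticeGreen_neg` (for the orientation `v ↦ Pker 0 (−v)`), and the kernel-level END of H2-ASM-1.  The only remaining hypotheses are the VERTEX letters
(bi-localisation + TOTAL zero mass per fibre block, E-FP-7-1).  No `def`, no `Prop` fact, nothing cited, 0 sorry.  NOT the bubble's VALUE∕germ (H2-ASM-3), NOT the tadpole,
NOT `hgerm`, NOT D1, NOT BetaPertH, NOT continuum, NOT Clay.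

CONTENT.
* §1 `legP_neg` (`legP α β (−z) = legP β α z`), `Pker_zero_inl_inl` (`Pker 0 v (inl α) (inl β) = legP α β v`), `Pker_zero_neg_inl_inl` (`Pker 0 (−v) (inl α) (inl γ) = legP γ α v`),
  `abs_Pker_le` (`|Pker x y a b| ≤ A0P`), `A0P_nonneg'`, `A3P_nonneg'`.
* §2 `letters_Pker_fwd` ∕ `letters_Pker_bwd`: the four-letter conjunction of `FP/ExpLocalisedBubbleMixed` for `v ↦ Pker 0 v f h` and `v ↦ Pker 0 (−v) a g`, EVERY fibre pair
  (field blocks by H2-ASM-2, the other blocks are `0`), constants `A0P, A1P, A2P, A3P`, exponents `2,3,4,5`.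
* §3 **`abs_bubble_Pker_sub_lead_le`**: for `V₀` bi-localised at `(0,0)`, `V₁` at `(z,z)`, both of total zero mass in every fibre block:
  `|bubble Pker V₀ V₁ − Σ_{a f g h} Lead_{afgh} z| ≤ 8⁴·KR(δ,C₀,C₁; A0P…A3P, 2; A0P…A3P, 2)/(‖z‖∞+1)⁷`.
Unit `b2b-balaban-beta-d1-formalise-leaf-02` (gen 8).
-/

noncomputable section

namespace Summit.QuantumFields.BalabanUV.Beta.FP.ExpLocalisedBubblePker

open Finset Filter Topology fwdDiff
open scoped BigOperators
open Literature.MathematicalPhysics.QuantumFieldTheory.Balaban1983to89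
open Literature.MathematicalPhysics.QuantumFieldTheory.Balaban1983to89.Beta
open Literature.Probability.LatticeModels (latticeGreen latticeGreen_neg)
open B12Sec2to5 (l1 l1_nonneg)
open ExpKernelCalculus (Site MKer Zl Zl_pos BiLoc bubble shiftK)
open OneStepResolventKernel (Fib)
open Summit.QuantumFields.BalabanUV.Beta.FP.ExpLocalisedBubblePoint (nonneg_of_decay_pow)
open Summit.QuantumFields.BalabanUV.Beta.FP.ExpLocalisedBubbleOrder2Point (Θ Zm K₀ K₁ K₂)
open Summit.QuantumFields.BalabanUV.Beta.FP.ExpLocalisedBubbleKernel (abs_bubble_kernel_sub_lead_le)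
open Summit.QuantumFields.BalabanUV.Beta.FP.PerfectPolarization (Pker Pker_inl_inl Pker_inl_inr Pker_inr_inl Pker_inr_inr Pker_translate)
open Summit.QuantumFields.BalabanUV.Beta.FP.PerfectPropagatorKernelSymm (KB_neg)
open Summit.QuantumFields.BalabanUV.Beta.FP.PerfectPropagatorLegData (legP legP_eq A0P A1P A2P A3P abs_legP_le)
open Summit.QuantumFields.BalabanUV.Beta.FP.PerfectPropagatorLegDataProducts (abs_fwdDiff_legP_le abs_fwdDiff₂_legP_le abs_fwdDiff₃_legP_le)
open DyadicShell (Pt supNorm supNorm_eq_zero_iff)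

/-! ## §1 The leg in both orientations -/

/-- [our object] **REFLECTION OF THE LEG**: `legP α β (−z) = legP β α z` (`latticeGreen` even, `KB_neg`). -/
theorem legP_neg (α β : Fin (3 + 1)) (z : Pt) : legP α β (-z) = legP β α z := by
  rw [legP_eq, legP_eq, latticeGreen_neg, KB_neg]
  by_cases h : α = β
  · subst h; rfl
  · rw [if_neg h, if_neg (Ne.symm h)]

/-- [our object] `Pker 0 v (inl α) (inl β) = legP α β v`. -/
theorem Pker_zero_inl_inl (v : Pt) (α β : Fin 4) : Pker 0 v (Sum.inl α) (Sum.inl β) = legP α β v := by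
  rw [Pker_inl_inl, sub_zero]; rfl

/-- [our object] `Pker 0 (−v) (inl α) (inl γ) = legP γ α v` (the reflected orientation is the transposed leg). -/
theorem Pker_zero_neg_inl_inl (v : Pt) (α γ : Fin 4) : Pker 0 (-v) (Sum.inl α) (Sum.inl γ) = legP γ α v := by
  rw [Pker_zero_inl_inl, legP_neg]

/-- [our object] `0 ≤ A0P` (read off (L0) at the origin). -/
theorem A0P_nonneg' : 0 ≤ A0P := nonneg_of_decay_pow (fun t => abs_legP_le 0 0 t)

/-- [our object] `0 ≤ A1P`, `0 ≤ A2P`, `0 ≤ A3P` (read off (L1)–(L3)). -/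
theorem A123P_nonneg' : 0 ≤ A1P ∧ 0 ≤ A2P ∧ 0 ≤ A3P :=
  ⟨nonneg_of_decay_pow (fun t => abs_fwdDiff_legP_le 0 0 0 t), nonneg_of_decay_pow (fun t => abs_fwdDiff₂_legP_le 0 0 0 0 t),
    nonneg_of_decay_pow (fun t => abs_fwdDiff₃_legP_le 0 0 0 0 0 t)⟩

/-- [our object] **THE LEG IS BOUNDED**: `|Pker x y a b| ≤ A0P`. -/
theorem abs_Pker_le (x y : Pt) (a b : Fib 3) : |Pker x y a b| ≤ A0P := by
  have hA := A0P_nonneg'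
  rcases a with α | α <;> rcases b with β | β
  · rw [Pker_inl_inl]
    have h := abs_legP_le α β (y - x)
    exact h.trans (div_le_self hA (one_le_pow₀ (by have := (Nat.cast_nonneg (supNorm (y - x)) : (0:ℝ) ≤ _); linarith)))
  · rw [Pker_inl_inr, abs_zero]; exact hA
  · rw [Pker_inr_inl, abs_zero]; exact hA
  · rw [Pker_inr_inr, abs_zero]; exact hA

/-! ## §2 The four-letter conjunctions for both orientations -/

/-- [folklore] The zero function satisfies any graded letters with nonnegative constants. -/
theorem letters_zero {A₀ A₁ A₂ A₃ : ℝ} (h0 : 0 ≤ A₀) (h1 : 0 ≤ A₁) (h2 : 0 ≤ A₂) (h3 : 0 ≤ A₃) (a : ℕ) (t : Pt) :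
    |(fun _ : Pt => (0 : ℝ)) t| ≤ A₀ / ((supNorm t : ℝ) + 1) ^ a
      ∧ (∀ i, |Δ_[(Pi.single i 1 : Pt)] (fun _ : Pt => (0 : ℝ)) t| ≤ A₁ / ((supNorm t : ℝ) + 1) ^ (a + 1))
      ∧ (∀ i j, |Δ_[(Pi.single i 1 : Pt)] (Δ_[(Pi.single j 1 : Pt)] (fun _ : Pt => (0 : ℝ))) t| ≤ A₂ / ((supNorm t : ℝ) + 1) ^ (a + 2))
      ∧ (∀ i j l, |Δ_[(Pi.single i 1 : Pt)] (Δ_[(Pi.single j 1 : Pt)] (Δ_[(Pi.single l 1 : Pt)] (fun _ : Pt => (0 : ℝ)))) t| ≤ A₃ / ((supNorm t : ℝ) + 1) ^ (a + 3)) := by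
  refine ⟨?_, fun i => ?_, fun i j => ?_, fun i j l => ?_⟩ <;> simp only [fwdDiff, sub_self, abs_zero] <;> positivity

/-- **THE FORWARD ORIENTATION `v ↦ Pker 0 v f h`** carries H2-ASM-2's letters (L0)–(L3) (constants `A0P, A1P, A2P, A3P`, exponents `2…5`) in EVERY fibre pair. [our object] -/
theorem letters_Pker_fwd (f h : Fib 3) (t : Pt) :
    |Pker 0 t f h| ≤ A0P / ((supNorm t : ℝ) + 1) ^ 2
      ∧ (∀ i, |Δ_[(Pi.single i 1 : Pt)] (fun v => Pker 0 v f h) t| ≤ A1P / ((supNorm t : ℝ) + 1) ^ (2 + 1))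
      ∧ (∀ i j, |Δ_[(Pi.single i 1 : Pt)] (Δ_[(Pi.single j 1 : Pt)] (fun v => Pker 0 v f h)) t| ≤ A2P / ((supNorm t : ℝ) + 1) ^ (2 + 2))
      ∧ (∀ i j l, |Δ_[(Pi.single i 1 : Pt)] (Δ_[(Pi.single j 1 : Pt)] (Δ_[(Pi.single l 1 : Pt)] (fun v => Pker 0 v f h))) t| ≤ A3P / ((supNorm t : ℝ) + 1) ^ (2 + 3)) := by
  obtain ⟨h1, h2, h3⟩ := A123P_nonneg'
  rcases f with α | α <;> rcases h with β | β
  · have e : (fun v : Pt => Pker 0 v (Sum.inl α) (Sum.inl β)) = legP α β := funext fun v => Pker_zero_inl_inl v α β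
    rw [Pker_zero_inl_inl, e]
    exact ⟨abs_legP_le α β t, fun i => abs_fwdDiff_legP_le α β i t, fun i j => abs_fwdDiff₂_legP_le α β i j t, fun i j l => abs_fwdDiff₃_legP_le α β i j l t⟩
  · have e : (fun v : Pt => Pker 0 v (Sum.inl α) (Sum.inr β)) = fun _ => 0 := funext fun v => Pker_inl_inr 0 v α β
    rw [Pker_inl_inr, e]; simpa using letters_zero A0P_nonneg' h1 h2 h3 2 t
  · have e : (fun v : Pt => Pker 0 v (Sum.inr α) (Sum.inl β)) = fun _ => 0 := funext fun v => Pker_inr_inl 0 v α β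
    rw [Pker_inr_inl, e]; simpa using letters_zero A0P_nonneg' h1 h2 h3 2 t
  · have e : (fun v : Pt => Pker 0 v (Sum.inr α) (Sum.inr β)) = fun _ => 0 := funext fun v => Pker_inr_inr 0 v α β
    rw [Pker_inr_inr, e]; simpa using letters_zero A0P_nonneg' h1 h2 h3 2 t

/-- **THE REFLECTED ORIENTATION `v ↦ Pker 0 (−v) a g`** carries the same letters (it is the transposed leg `legP γ α`). [our object] -/
theorem letters_Pker_bwd (a g : Fib 3) (t : Pt) :
    |Pker 0 (-t) a g| ≤ A0P / ((supNorm t : ℝ) + 1) ^ 2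
      ∧ (∀ i, |Δ_[(Pi.single i 1 : Pt)] (fun v => Pker 0 (-v) a g) t| ≤ A1P / ((supNorm t : ℝ) + 1) ^ (2 + 1))
      ∧ (∀ i j, |Δ_[(Pi.single i 1 : Pt)] (Δ_[(Pi.single j 1 : Pt)] (fun v => Pker 0 (-v) a g)) t| ≤ A2P / ((supNorm t : ℝ) + 1) ^ (2 + 2))
      ∧ (∀ i j l, |Δ_[(Pi.single i 1 : Pt)] (Δ_[(Pi.single j 1 : Pt)] (Δ_[(Pi.single l 1 : Pt)] (fun v => Pker 0 (-v) a g))) t| ≤ A3P / ((supNorm t : ℝ) + 1) ^ (2 + 3)) := by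
  obtain ⟨h1, h2, h3⟩ := A123P_nonneg'
  rcases a with α | α <;> rcases g with γ | γ
  · have e : (fun v : Pt => Pker 0 (-v) (Sum.inl α) (Sum.inl γ)) = legP γ α := funext fun v => Pker_zero_neg_inl_inl v α γ
    rw [Pker_zero_neg_inl_inl, e]
    exact ⟨abs_legP_le γ α t, fun i => abs_fwdDiff_legP_le γ α i t, fun i j => abs_fwdDiff₂_legP_le γ α i j t, fun i j l => abs_fwdDiff₃_legP_le γ α i j l t⟩
  · have e : (fun v : Pt => Pker 0 (-v) (Sum.inl α) (Sum.inr γ)) = fun _ => 0 := funext fun v => Pker_inl_inr 0 (-v) α γ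
    rw [Pker_inl_inr, e]; simpa using letters_zero A0P_nonneg' h1 h2 h3 2 t
  · have e : (fun v : Pt => Pker 0 (-v) (Sum.inr α) (Sum.inl γ)) = fun _ => 0 := funext fun v => Pker_inr_inl 0 (-v) α γ
    rw [Pker_inr_inl, e]; simpa using letters_zero A0P_nonneg' h1 h2 h3 2 t
  · have e : (fun v : Pt => Pker 0 (-v) (Sum.inr α) (Sum.inr γ)) = fun _ => 0 := funext fun v => Pker_inr_inr 0 (-v) α γ
    rw [Pker_inr_inr, e]; simpa using letters_zero A0P_nonneg' h1 h2 h3 2 t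

/-! ## §3 The bubble of the perfect gluon leg -/

variable {V₀ V₁ : MKer 4 (Fib 3)} {C₀ C₁ δ : ℝ} {z : Pt}

/-- **JUNCTION H2-ASM-1 ∘ H2-ASM-2 — THE BUBBLE OF `Pker` EXPANDED**: for vertices `V₀` bi-localised at `(0,0)`, `V₁` at `(z,z)`, both of TOTAL zero mass in every fibre block,
`|bubble Pker V₀ V₁ − Σ_{a f g h} Lead_{afgh} z| ≤ 8⁴·KR/(‖z‖∞+1)⁷` with the leg constants `A0P…A3P` of H2-ASM-2 in both slots (`KR` written out; `Lead_{afgh}` as in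
`FP/ExpLocalisedBubbleKernel`, legs `v ↦ Pker 0 (−v) a g` ∕ `v ↦ Pker 0 v f h` — field blocks `legP γ α` ∕ `legP φ η` by `Pker_zero_neg_inl_inl` ∕ `Pker_zero_inl_inl`, other blocks `0`). [our object] -/
theorem abs_bubble_Pker_sub_lead_le (hδ : 0 < δ) (hV₀ : BiLoc V₀ 0 0 C₀ δ) (hV₁ : BiLoc V₁ z z C₁ δ)
    (h0₀ : ∀ (g f : Fib 3), ∑' p : Pt × Pt, V₀ p.1 p.2 g f = 0) (h0₁ : ∀ (h a : Fib 3), ∑' q : Pt × Pt, V₁ q.1 q.2 h a = 0) :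
    |bubble Pker V₀ V₁
        - ∑ a', ∑ f, ∑ g, ∑ h, (-∑ i, ∑ j,
            ((∑' p : Pt × Pt, V₀ p.1 p.2 g f * (p.1 i : ℝ)) * (∑' p : Pt × Pt, V₁ (z + p.2) (z + p.1) h a' * (p.1 j : ℝ))
              * (Pker 0 z f h * Δ_[(Pi.single i 1 : Pt)] (Δ_[(Pi.single j 1 : Pt)] (fun v => Pker 0 (-v) a' g)) z)
            + (∑' p : Pt × Pt, V₀ p.1 p.2 g f * (p.1 i : ℝ)) * (∑' p : Pt × Pt, V₁ (z + p.2) (z + p.1) h a' * (p.2 j : ℝ))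
              * (Δ_[(Pi.single i 1 : Pt)] (fun v => Pker 0 (-v) a' g) z * Δ_[(Pi.single j 1 : Pt)] (fun v => Pker 0 v f h) z)
            + (∑' p : Pt × Pt, V₀ p.1 p.2 g f * (p.2 i : ℝ)) * (∑' p : Pt × Pt, V₁ (z + p.2) (z + p.1) h a' * (p.1 j : ℝ))
              * (Δ_[(Pi.single j 1 : Pt)] (fun v => Pker 0 (-v) a' g) z * Δ_[(Pi.single i 1 : Pt)] (fun v => Pker 0 v f h) z)
            + (∑' p : Pt × Pt, V₀ p.1 p.2 g f * (p.2 i : ℝ)) * (∑' p : Pt × Pt, V₁ (z + p.2) (z + p.1) h a' * (p.2 j : ℝ))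
              * (Pker 0 (-z) a' g * Δ_[(Pi.single i 1 : Pt)] (Δ_[(Pi.single j 1 : Pt)] (fun v => Pker 0 v f h)) z)))|
      ≤ (Fintype.card (Fib 3) : ℝ) ^ 4 * (A0P * ((C₁ * Zl 4 δ) * (C₀ * Zl 4 δ) * K₂ δ A0P A1P A2P A3P 2)
          + 4 * A1P * ((C₁ * Zm δ 1) * (C₀ * Zl 4 δ) * K₁ δ A0P A1P A2P 2 + (C₁ * Zl 4 δ) * (C₀ * Zm δ 1) * K₁ δ A0P A1P A2P 2)
          + A0P * ((C₁ * Zl 4 δ) * (C₀ * Zl 4 δ) * K₂ δ A0P A1P A2P A3P 2)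
          + (C₀ * C₁ * K₁ δ A0P A1P A2P 2) * K₀ δ A0P A1P 2) / ((supNorm z : ℝ) + 1) ^ (2 + 2 + 3) :=
  abs_bubble_kernel_sub_lead_le (A := Pker) (CA := A0P) hδ abs_Pker_le Pker_translate hV₀ hV₁ h0₀ h0₁
    (fun a' g t => letters_Pker_bwd a' g t) (fun f h t => letters_Pker_fwd f h t)

end Summit.QuantumFields.BalabanUV.Beta.FP.ExpLocalisedBubblePker

end
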